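import Mathlib
import HarnessLib

/-!
# ζ(5) search — denominator PRODUCT RULE for elimination minors (cell `pub-zeta5`, fam-denom)

HONEST FRAMING: systematic search; no irrationality claim unless certified.

Elementary, fully proved bookkeeping used by every ELIMINATION / TELESCOPING step of the search
(families `elim`, `tele`, `odd`, `vwp`): if two linear forms `Σ_k a_k θ_k`, `Σ_k b_k θ_k` have
coefficient denominators `Da_k · a_k ∈ ℤ`, `Db_k · b_k ∈ ℤ`, then the form eliminating `θ_s`,
`b_s · (Σ a_k θ_k) − a_s · (Σ b_k θ_k) = Σ_k (a_k b_s − a_s b_k) θ_k`, has coefficients (2 × 2 minors) with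
denominators dividing `lcm (Da_k · Db_s) (Da_s · Db_k)` — the "product rule" (grade T in
`families/denom/FAMILY.md` §2, row `elim`).  Anything BELOW this bound seen in tables (e.g. the integrality of the
`ζ(5)`-minor `u·w̃ − ũ·w` of Zudilin's 2002 pair `r_n, r̃_n`, observed for `n ≤ 10`) is extra cancellation that this
file does NOT provide.

Contents: the scalar predicate `x ∈ dInt D` (`D · x ∈ ℤ`), its ring rules, the minor rule with uniform and with
per-coordinate denominators, and the `m`-term eliminated-form corollary.
-/

namespace Summit.KontsevichZagierPeriods.Zeta5Search.Denom

/-- `dInt D` : the rationals `x` for which the natural number `D` is a denominator, i.e. `D · x ∈ ℤ`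
(a `Set ℚ`; the lemmas below are its ring rules, in the namespace `DInt` for dot-free short names). -/
def dInt (D : ℕ) : Set ℚ := {x | ∃ z : ℤ, (D : ℚ) * x = z}

/-- Membership in `dInt D`: `D · x ∈ ℤ`. -/
theorem mem_dInt {D : ℕ} {x : ℚ} : x ∈ dInt D ↔ ∃ z : ℤ, (D : ℚ) * x = z := Iff.rfl

namespace DInt

/-- Integers lie in `dInt D`. -/
theorem of_int (D : ℕ) (z : ℤ) : (z : ℚ) ∈ dInt D := mem_dInt.2 ⟨D * z, by push_cast; ring⟩

/-- `0 ∈ dInt D`. -/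
theorem zero (D : ℕ) : (0 : ℚ) ∈ dInt D := mem_dInt.2 ⟨0, by simp⟩

/-- `dInt 1` is the set of integers. -/
theorem one_iff_int (x : ℚ) : x ∈ dInt 1 ↔ ∃ z : ℤ, x = z := by
  simp [mem_dInt]

/-- `dInt D` is closed under addition. -/
theorem add {D : ℕ} {x y : ℚ} (hx : x ∈ dInt D) (hy : y ∈ dInt D) : (x + y) ∈ dInt D := by
  obtain ⟨a, ha⟩ := mem_dInt.1 hx; obtain ⟨b, hb⟩ := mem_dInt.1 hy
  exact mem_dInt.2 ⟨a + b, by push_cast; rw [mul_add, ha, hb]⟩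

/-- `dInt D` is closed under negation. -/
theorem neg {D : ℕ} {x : ℚ} (hx : x ∈ dInt D) : (-x) ∈ dInt D := by
  obtain ⟨a, ha⟩ := mem_dInt.1 hx; exact mem_dInt.2 ⟨-a, by push_cast; rw [mul_neg, ha]⟩

/-- `dInt D` is closed under subtraction. -/
theorem sub {D : ℕ} {x y : ℚ} (hx : x ∈ dInt D) (hy : y ∈ dInt D) : (x - y) ∈ dInt D := by
  simpa [sub_eq_add_neg] using DInt.add hx (DInt.neg hy)

/-- Product rule: denominators multiply. -/
theorem mul {D₁ D₂ : ℕ} {x y : ℚ} (hx : x ∈ dInt D₁) (hy : y ∈ dInt D₂) : (x * y) ∈ dInt (D₁ * D₂) := by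
  obtain ⟨a, ha⟩ := mem_dInt.1 hx; obtain ⟨b, hb⟩ := mem_dInt.1 hy
  refine mem_dInt.2 ⟨a * b, ?_⟩
  push_cast
  calc (D₁ : ℚ) * D₂ * (x * y) = ((D₁ : ℚ) * x) * ((D₂ : ℚ) * y) := by ring
    _ = a * b := by rw [ha, hb]

/-- Integer multiples keep the denominator. -/
theorem int_mul {D : ℕ} {x : ℚ} (z : ℤ) (hx : x ∈ dInt D) : (z * x) ∈ dInt D := by
  obtain ⟨a, ha⟩ := mem_dInt.1 hx
  exact mem_dInt.2 ⟨z * a, by push_cast; rw [mul_left_comm, ha]⟩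

/-- Monotonicity: any multiple of a denominator is a denominator. -/
theorem mono {D D' : ℕ} {x : ℚ} (h : D ∣ D') (hx : x ∈ dInt D) : x ∈ dInt D' := by
  obtain ⟨k, rfl⟩ := h
  obtain ⟨a, ha⟩ := mem_dInt.1 hx
  refine mem_dInt.2 ⟨k * a, ?_⟩
  push_cast
  calc (D : ℚ) * k * x = k * ((D : ℚ) * x) := by ring
    _ = k * a := by rw [ha]

/-- `dInt D₁ ⊆ dInt (lcm D₁ D₂)`. -/
theorem lcm_left {D₁ D₂ : ℕ} {x : ℚ} (hx : x ∈ dInt D₁) : x ∈ dInt (Nat.lcm D₁ D₂) :=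
  DInt.mono (Nat.dvd_lcm_left D₁ D₂) hx

/-- `dInt D₂ ⊆ dInt (lcm D₁ D₂)`. -/
theorem lcm_right {D₁ D₂ : ℕ} {x : ℚ} (hx : x ∈ dInt D₂) : x ∈ dInt (Nat.lcm D₁ D₂) :=
  DInt.mono (Nat.dvd_lcm_right D₁ D₂) hx

/-- Finite sums. -/
theorem sum {ι : Type*} (s : Finset ι) {D : ℕ} {f : ι → ℚ} (h : ∀ i ∈ s, (f i) ∈ dInt D) :
    (∑ i ∈ s, f i) ∈ dInt D := by
  classical
  induction s using Finset.induction_on with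
  | empty => simpa using DInt.zero D
  | insert a s ha ih =>
    rw [Finset.sum_insert ha]
    exact DInt.add (h a (Finset.mem_insert_self a s)) (ih fun i hi => h i (Finset.mem_insert_of_mem hi))

end DInt

/-! ### The product rule for 2 × 2 minors -/

/-- Uniform denominators: `Da · a_k ∈ ℤ`, `Db · b_k ∈ ℤ` for all `k` ⇒ `Da·Db · (a_i b_j − a_j b_i) ∈ ℤ`. -/
theorem minor_dInt {ι : Type*} {Da Db : ℕ} {a b : ι → ℚ}
    (ha : ∀ k, (a k) ∈ dInt Da) (hb : ∀ k, (b k) ∈ dInt Db) (i j : ι) :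
    (a i * b j - a j * b i) ∈ dInt (Da * Db) :=
  DInt.sub (DInt.mul (ha i) (hb j)) (DInt.mul (ha j) (hb i))

/-- Per-coordinate denominators: `Da_k · a_k ∈ ℤ`, `Db_k · b_k ∈ ℤ` ⇒ the minor `a_i b_j − a_j b_i` has denominator
dividing `lcm (Da_i · Db_j) (Da_j · Db_i)` (e.g. Zudilin 2002: `(1, d², 4d⁵)` and `(1, d², 4d³)`-type vectors give
`4 d⁵` for the constant-term minor, not `4 d⁷`). -/
theorem minor_dInt' {ι : Type*} {Da Db : ι → ℕ} {a b : ι → ℚ}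
    (ha : ∀ k, (a k) ∈ dInt (Da k)) (hb : ∀ k, (b k) ∈ dInt (Db k)) (i j : ι) :
    (a i * b j - a j * b i) ∈ dInt (Nat.lcm (Da i * Db j) (Da j * Db i)) :=
  DInt.sub (DInt.lcm_left (DInt.mul (ha i) (hb j))) (DInt.lcm_right (DInt.mul (ha j) (hb i)))

/-! ### The eliminated form -/

/-- Eliminating the `s`-th period from two forms: the coefficient vector of `b_s · A − a_s · B`. -/
def elimCoeff {ι : Type*} (a b : ι → ℚ) (s : ι) : ι → ℚ := fun k => a k * b s - a s * b k

/-- The eliminated coordinate of `elimCoeff a b s` vanishes. -/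
theorem elimCoeff_self {ι : Type*} (a b : ι → ℚ) (s : ι) : elimCoeff a b s s = 0 := by
  simp [elimCoeff]

/-- The eliminated form is the stated combination of the two forms (any coefficient ring element family `θ`). -/
theorem elimCoeff_sum {ι : Type*} [Fintype ι] (a b : ι → ℚ) (s : ι) (θ : ι → ℝ) :
    ∑ k, (elimCoeff a b s k : ℝ) * θ k = (b s : ℝ) * ∑ k, (a k : ℝ) * θ k - (a s : ℝ) * ∑ k, (b k : ℝ) * θ k := by
  simp only [elimCoeff, Rat.cast_sub, Rat.cast_mul, Finset.mul_sum]
  rw [← Finset.sum_sub_distrib]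
  refine Finset.sum_congr rfl fun k _ => ?_
  ring

/-- PRODUCT RULE (uniform denominators) for every coefficient of the eliminated form. -/
theorem elimCoeff_dInt {ι : Type*} {Da Db : ℕ} {a b : ι → ℚ}
    (ha : ∀ k, (a k) ∈ dInt Da) (hb : ∀ k, (b k) ∈ dInt Db) (s k : ι) :
    (elimCoeff a b s k) ∈ dInt (Da * Db) :=
  minor_dInt ha hb k s

/-- PRODUCT RULE (per-coordinate denominators) for every coefficient of the eliminated form. -/
theorem elimCoeff_dInt' {ι : Type*} {Da Db : ι → ℕ} {a b : ι → ℚ}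
    (ha : ∀ k, (a k) ∈ dInt (Da k)) (hb : ∀ k, (b k) ∈ dInt (Db k)) (s k : ι) :
    (elimCoeff a b s k) ∈ dInt (Nat.lcm (Da k * Db s) (Da s * Db k)) :=
  minor_dInt' ha hb k s

/-- Sanity instance (Zudilin 2002, n = 2, from `families/denom/PROFILES.md`): with `a = (u, w, v) = (469, 6125/4, 74463/32)`
(`Da = (1, 4, 32)`) and `b = (ũ, w̃, ṽ) = (552, 1764, 43085/16)` (`Db = (1, 1, 16)`), the rule bounds the denominator of the
constant-term minor `w ṽ − w̃ v` by `lcm (4·16) (32·1) = 64`; the actual value is `1190161/64 = −p₂` (Zudilin's 2002 recursion), denominator exactly `64`. -/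
example : ((6125 / 4 : ℚ) * (43085 / 16) - 1764 * (74463 / 32)) ∈ dInt (Nat.lcm (4 * 16) (1 * 32)) := by
  refine mem_dInt.2 ⟨1190161, ?_⟩
  norm_num [Nat.lcm]


end Summit.KontsevichZagierPeriods.Zeta5Search.Denom
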